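import Literature.IUT.HodgeTheaters.HodgeTheaterModelFKitWitness
import Literature.IUT.HodgeTheaters.InitialThetaDataPlaces
import HarnessLib

/-!
# [IUTchI] Corollary 5.6 (i), sub-DAG row L03 at the §3 ↔ §5 link: the residual law on `HodgeTheaterModel`, and its
# independence (proof-only companion)

S. Mochizuki, *Inter-universal Teichmüller theory I*, kurims manuscript (May 2020), §5, Corollary 5.6 (i), statement
p. 153 l. 67–70, proof p. 154 l. 8–24; Remark 5.2.1 (ii) p. 143; Definition 3.6 (c) p. 87; Example 3.5 (ii) p. 85
([IUTchI] Cor 5.6 (i) p.154) [claim: Mochizuki2012, status: disputed] (D-0012 claim key; series status DISPUTED — this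
file asserts nothing of the series and takes no side on [IUTchIII] Cor. 3.12).

Proof-only companion (abc-iut cell, seat abc-iut-w5-d217, writer of record of plan/L5/SUBDAG-IUTchI-Cor56i.md; 0
definitions, no new named `Prop`) of

* `ThetaHodgeTheatersCor56iSub.lean` (p414027): over abc-iut-L5-t4's kit `PMBaseKit.FKit`, Cor 5.6 (i) (`Cor56iKit`) was
  PROVED equivalent — given Cor 5.3 (ii), (iv) BY NAME and the good-place transparency L02 — to the single row L03
  `RlfDetermined` ("this global data may be obtained by applying the functorial algorithm "`‡𝔉 ↦ ‡𝔉^⊩`" … to the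
  associated `ℱ`-prime-strips", p. 154 l. 16–20), cut as L03a `RlfIsoFaithful` ("rigidity of the divisor monoids",
  Rmk 5.2.1 (ii)) + L03b `RlfIsoLifts`;
* `HodgeTheaterModelFKit.lean` (p419124, abc-iut-L5-t3): the §3 ↔ §5 dictionary `HodgeTheaterModel.FKitLink Mo T M` and the
  constructor `FKitLink.toFKit`, under which L02 HOLDS (`FKitLink.thToFBijOnGood`) and "row L03 … becomes the two LAWS of
  the realification functor (adapter C2)".

WHAT IS PROVED HERE (the C2 reading made exact, in the kernel):

1. (any kit) `rlfDetermined_iff_faithful_and_lifts` — row L03 (`∃!`) is EQUIVALENT to L03a ∧ L03b (the converse of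
   `rlfDetermined_of`: uniqueness for one family of local isomorphisms gives joint faithfulness, by re-framing the
   identification `rlf_fm` of Def 3.6 (c)).
2. (any kit whose `𝔉^⊩_mod ↦ ℱ^⊢_v` components are isomorphs of the models `ℱ^⊢_v` — the hypothesis `h` of abc-iut-L5-t4's
   `FrStrip.fmStrip`, a consequence of Rmk 5.2.1 (ii) `RlfOfIsStrip` by `nonempty_rlfFm_rlfModel_iso_of_rlfOfIsStrip`)
   `rlfIsoFaithful_iff_component_injective`, `rlfIsoLifts_iff_component_surjective`,
   `rlfDetermined_iff_component_bijective`: the rows are EQUIVALENT to injectivity / surjectivity / bijectivity of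
   `r ↦ {(rlfFm v).mapIso r}_v` on isomorphisms between isomorphs of `𝔉^⊩_mod` — Θ-Hodge theaters no longer appear.
   (Reason: the typed Θ-Hodge theater `FKit.ThetaHT` records Def 3.6 (c) "`†ℱ^⊢_v̲` is as discussed in (a), (b)" as an
   ARBITRARY identification `rlf_fm`, so every family of isomorphisms of `ℱ^⊢`-components is the compatibility datum of
   some pair of framed theaters with identity local part.)  Hence `cor56iKit_iff_component_bijective`.
3. (the link) `FKitLink.rlfDetermined_iff_component_bijective`, `FKitLink.cor56iKit_iff_component_bijective`: for the
   kit `L.toFKit` of ANY link `L` over `Mo : HodgeTheaterModel D`, given Cor 5.3 (ii), (iv) by name, **Cor 5.6 (i) is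
   EQUIVALENT to one law on abc-iut-L5-t2's interface alone** — for `A, B : Mo.Glob` isomorphic to `𝔉^⊩_mod`,
   `(A ≅ B) → ∏_{v̲ ∈ V̲} ((Mo.component v̲).obj A ≅ (Mo.component v̲).obj B)`, `r ↦ {component_v̲ (r)}`, is bijective
   ("an isomorphism of collections of data `(𝒞^⊩, Prime(𝒞^⊩) ⥲ V̲, {ℱ^⊢_v̲}, {ρ_v̲})` is determined by, and any family
   of isomorphisms of the `ℱ^⊢_v̲` extends to, its `ℱ^⊢`-prime-strip part"; Rmk 5.2.1 (ii) p. 143, Ex 3.5 (ii) p. 85,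
   Rmk 3.5.2).  The law does not mention `L`, `T`, `M`: it is the exact residual of node IUTchI:Cor5.6(i) on the §3
   side (plan/GAP-LEDGER.md row G-w5d217-1; an interface LAW to be supplied by the `HodgeTheaterModel` owner or proved at
   the genuine model of Example 3.5 — NOT a new fact).
4. (independence at the interface level) at abc-iut-L5-t3's KIT-RULE inhabitant `HodgeTheaterModel.unitsLink D` (p420488:
   every kind the one-object groupoid on `{±1}`, `component = 𝟭`) the law FAILS for every initial Θ-datum `D` — a
   non-constant family of signs over the infinite set `V̲` (`InitialThetaData.infinite_coe_V`) is not induced by a single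
   sign — although L02 and Cor 5.3 (ii), (iv) HOLD there; so `¬ (unitsLink D).toFKit.Cor56iKit`
   (`not_cor56iKit_unitsLink`): Cor 5.6 (i) is NOT a consequence of the `HodgeTheaterModel` axioms (incl. the fullness
   laws `componentBase_full`, `componentUnits_full`) + the C1 dictionary + Cor 5.3 (ii), (iv).  (Interface-level
   analogue of `exists_fkit_not_rlfDetermined`, p415205.)

Typed ≠ proved for the genuine model; no side is taken on [IUTchIII] Cor 3.12.
-/

namespace Literature.IUT.HodgeTheaters

open CategoryTheory

universe uK u v w

namespace PMBaseKit

namespace FKit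

variable {l : ℕ} {K : PMBaseKit.{uK} l} {M : K.MultKit} {FK : K.FKit M}

/-! ### Row L03 ⟺ L03a ∧ L03b (any kit) -/

/-- L03 ⇒ L03b: unique existence gives existence. ([IUTchI] Cor 5.6 (i) p.154) [claim: Mochizuki2012, status: disputed] -/
theorem rlfIsoLifts_of_rlfDetermined (h : FK.RlfDetermined) : FK.RlfIsoLifts := fun H₁ H₂ t =>
  (h H₁ H₂ t).exists

/-- L03 ⇒ L03a ("rigidity": an isomorphism of global realified data is determined by its `ℱ^⊢`-components, Rmk 5.2.1
(ii) p. 143): re-frame the second Θ-Hodge theater along `a` (Def 3.6 (c) records the identification `rlf_fm` as a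
datum), so that `a` and any `b` with the same components are both compatible with the identity local family; then
uniqueness in L03 gives `a = b`. PROVED. ([IUTchI] Rmk 5.2.1 (ii) p.143) [claim: Mochizuki2012, status: disputed] -/
theorem rlfIsoFaithful_of_rlfDetermined (h : FK.RlfDetermined) : FK.RlfIsoFaithful := by
  intro H₁ H₂ a b hab
  let H₂' : FK.ThetaHT :=
    { th := H₁.th, th_isModel := H₁.th_isModel, rlf := H₂.rlf, rlf_isModel := H₂.rlf_isModel
      rlf_fm := fun v => ((FK.rlfFm v).mapIso a).symm ≪≫ H₁.rlf_fm v }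
  have hc : ∀ c : H₁.rlf ≅ H₂.rlf, (∀ v, (FK.rlfFm v).map c.hom = (FK.rlfFm v).map a.hom) →
      ThetaHT.RlfCompat H₁ H₂' (fun v => Iso.refl _) c := by
    intro c hc v
    show (FK.rlfFm v).map c.hom ≫ (((FK.rlfFm v).mapIso a).symm ≪≫ H₁.rlf_fm v).hom =
      (H₁.rlf_fm v).hom ≫ (FK.toFm v).map ((FK.thToF v).map (Iso.refl _).hom)
    rw [hc v]
    simp
  obtain ⟨r, -, huniq⟩ := h H₁ H₂' fun v => Iso.refl _
  exact (huniq a (hc a fun v => rfl)).trans (huniq b (hc b fun v => (hab v).symm)).symm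

/-- **Row L03 ⟺ L03a ∧ L03b** at any kit (`rlfDetermined_of` and its converse). PROVED.
([IUTchI] Cor 5.6 (i) p.154) [claim: Mochizuki2012, status: disputed] -/
theorem rlfDetermined_iff_faithful_and_lifts : FK.RlfDetermined ↔ FK.RlfIsoFaithful ∧ FK.RlfIsoLifts :=
  ⟨fun h => ⟨rlfIsoFaithful_of_rlfDetermined h, rlfIsoLifts_of_rlfDetermined h⟩,
    fun h => rlfDetermined_of h.1 h.2⟩

/-! ### The rows as properties of `𝔉^⊩ ↦ {ℱ^⊢_v}_v` alone (Θ-Hodge theaters eliminated) -/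

/-- Frames: if the components of `𝔉^⊩_mod` are isomorphs of the models `ℱ^⊢_v` (hypothesis `h` of `FrStrip.fmStrip`;
⇐ Rmk 5.2.1 (ii) `RlfOfIsStrip`), then every isomorph `A` of `𝔉^⊩_mod` admits identifications
`(rlfFm v)(A) ≅ (ℱ̲_v)^⊢` — i.e. occurs as the global realified datum of a Θ-Hodge theater with MODEL local data
(Def 3.6 (c)). PROVED. ([IUTchI] Def 3.6 p.87) [claim: Mochizuki2012, status: disputed] -/
theorem nonempty_frame (hfr : ∀ v, Nonempty ((FK.rlfFm v).obj FK.rlfModel ≅ FK.fmModel v))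
    {A : FK.RlfAmb} (hA : Nonempty (A ≅ FK.rlfModel)) (v : K.V) :
    Nonempty ((FK.rlfFm v).obj A ≅ (FK.toFm v).obj ((FK.thToF v).obj (FK.thModel v))) :=
  ⟨(FK.rlfFm v).mapIso hA.some ≪≫ (hfr v).some ≪≫ (FK.toFm_model v).symm ≪≫
    (FK.toFm v).mapIso (FK.thToF_model v).symm⟩

/-- **L03a ⟺ injectivity on components** (Rmk 5.2.1 (ii) p. 143 "rigidity of the divisor monoids …"): row
`RlfIsoFaithful` holds iff for all isomorphs `A, B` of `𝔉^⊩_mod` the map `r ↦ {(rlfFm v).mapIso r}_v` on `Isom(A, B)` is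
injective.  (⇒: apply the row to the model-framed theaters on `A`, `B`; ⇐: immediate.) PROVED.
([IUTchI] Rmk 5.2.1 (ii) p.143) [claim: Mochizuki2012, status: disputed] -/
theorem rlfIsoFaithful_iff_component_injective
    (hfr : ∀ v, Nonempty ((FK.rlfFm v).obj FK.rlfModel ≅ FK.fmModel v)) :
    FK.RlfIsoFaithful ↔
      ∀ (A B : FK.RlfAmb), Nonempty (A ≅ FK.rlfModel) → Nonempty (B ≅ FK.rlfModel) →
        Function.Injective fun r : A ≅ B => fun v => (FK.rlfFm v).mapIso r := by
  constructor
  · intro h A B hA hB r s hrs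
    let HA : FK.ThetaHT :=
      ⟨FK.thModel, fun _ => ⟨Iso.refl _⟩, A, hA, fun v => (nonempty_frame hfr hA v).some⟩
    let HB : FK.ThetaHT :=
      ⟨FK.thModel, fun _ => ⟨Iso.refl _⟩, B, hB, fun v => (nonempty_frame hfr hB v).some⟩
    exact h HA HB r s fun v => congrArg Iso.hom (congrFun hrs v)
  · intro h H₁ H₂ a b hab
    exact h H₁.rlf H₂.rlf H₁.rlf_isModel H₂.rlf_isModel (funext fun v => Iso.ext (hab v))

/-- **L03b ⟺ surjectivity on components** (p. 154 l. 16–20, the functorial algorithm "`‡𝔉 ↦ ‡𝔉^⊩`"): row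
`RlfIsoLifts` holds iff for all isomorphs `A, B` of `𝔉^⊩_mod` every family of isomorphisms of the `ℱ^⊢`-components
`{(rlfFm v)(A) ≅ (rlfFm v)(B)}_v` is induced by an isomorphism `A ≅ B`.  (⇒: frame `B` by the model, frame `A` by the
given family followed by that frame, and lift the IDENTITY local family; ⇐: lift the family
`rlf_fm₁ ≫ (t_v)^⊢ ≫ rlf_fm₂⁻¹`.)  NB: because the typed identification `rlf_fm` of Def 3.6 (c) is arbitrary, the typed
row asks for lifts of ALL families of `ℱ^⊢`-isomorphisms, not only of those induced by holomorphic families at the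
canonical identification. PROVED. ([IUTchI] Cor 5.6 (i) p.154) [claim: Mochizuki2012, status: disputed] -/
theorem rlfIsoLifts_iff_component_surjective
    (hfr : ∀ v, Nonempty ((FK.rlfFm v).obj FK.rlfModel ≅ FK.fmModel v)) :
    FK.RlfIsoLifts ↔
      ∀ (A B : FK.RlfAmb), Nonempty (A ≅ FK.rlfModel) → Nonempty (B ≅ FK.rlfModel) →
        Function.Surjective fun r : A ≅ B => fun v => (FK.rlfFm v).mapIso r := by
  constructor
  · intro h A B hA hB d
    let fB : ∀ v, (FK.rlfFm v).obj B ≅ (FK.toFm v).obj ((FK.thToF v).obj (FK.thModel v)) :=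
      fun v => (nonempty_frame hfr hB v).some
    let HA : FK.ThetaHT := ⟨FK.thModel, fun _ => ⟨Iso.refl _⟩, A, hA, fun v => d v ≪≫ fB v⟩
    let HB : FK.ThetaHT := ⟨FK.thModel, fun _ => ⟨Iso.refl _⟩, B, hB, fB⟩
    obtain ⟨r, hr⟩ := h HA HB fun v => Iso.refl _
    refine ⟨r, funext fun v => Iso.ext ?_⟩
    have hv := hr v
    change (FK.rlfFm v).map r.hom ≫ (fB v).hom =
      (d v ≪≫ fB v).hom ≫ (FK.toFm v).map ((FK.thToF v).map (Iso.refl _).hom) at hv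
    simp only [Iso.refl_hom, CategoryTheory.Functor.map_id, Category.comp_id, Iso.trans_hom] at hv
    exact (Iso.cancel_iso_hom_right _ _ (fB v)).mp hv
  · intro h H₁ H₂ t
    obtain ⟨r, hr⟩ := h H₁.rlf H₂.rlf H₁.rlf_isModel H₂.rlf_isModel fun v =>
      H₁.rlf_fm v ≪≫ (FK.toFm v).mapIso ((FK.thToF v).mapIso (t v)) ≪≫ (H₂.rlf_fm v).symm
    refine ⟨r, fun v => ?_⟩
    have hv := congrArg Iso.hom (congrFun hr v)
    change (FK.rlfFm v).map r.hom =
      (H₁.rlf_fm v ≪≫ (FK.toFm v).mapIso ((FK.thToF v).mapIso (t v)) ≪≫ (H₂.rlf_fm v).symm).hom at hv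
    rw [hv]
    simp only [Iso.trans_hom, Functor.mapIso_hom, Iso.symm_hom, Category.assoc, Iso.inv_hom_id,
      Category.comp_id]

/-- **Row L03 ⟺ bijectivity on components**: for all isomorphs `A, B` of `𝔉^⊩_mod`,
`Isom(A, B) → ∏_v Isom((rlfFm v)(A), (rlfFm v)(B))` is bijective — "the global realified datum carries no isomorphism data
beyond its `ℱ^⊢`-prime-strip, and every family of `ℱ^⊢`-isomorphisms is realised". PROVED.
([IUTchI] Cor 5.6 (i) p.154) [claim: Mochizuki2012, status: disputed] -/
theorem rlfDetermined_iff_component_bijective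
    (hfr : ∀ v, Nonempty ((FK.rlfFm v).obj FK.rlfModel ≅ FK.fmModel v)) :
    FK.RlfDetermined ↔
      ∀ (A B : FK.RlfAmb), Nonempty (A ≅ FK.rlfModel) → Nonempty (B ≅ FK.rlfModel) →
        Function.Bijective fun r : A ≅ B => fun v => (FK.rlfFm v).mapIso r := by
  rw [rlfDetermined_iff_faithful_and_lifts, rlfIsoFaithful_iff_component_injective hfr,
    rlfIsoLifts_iff_component_surjective hfr]
  exact ⟨fun h A B hA hB => ⟨h.1 A B hA hB, h.2 A B hA hB⟩,
    fun h => ⟨fun A B hA hB => (h A B hA hB).1, fun A B hA hB => (h A B hA hB).2⟩⟩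

/-- **Cor 5.6 (i) over the kit ⟺ bijectivity on components** (given L02 and Cor 5.3 (ii), (iv) by name; via
`cor56iKit_iff_rlfDetermined`). PROVED. ([IUTchI] Cor 5.6 (i) p.153) [claim: Mochizuki2012, status: disputed] -/
theorem cor56iKit_iff_component_bijective
    (hfr : ∀ v, Nonempty ((FK.rlfFm v).obj FK.rlfModel ≅ FK.fmModel v))
    (h02 : FK.ThToFBijOnGood) (h53ii : FK.IsomFtoDBijective) (h53iv : FK.AutTemperedBijective) :
    FK.Cor56iKit ↔
      ∀ (A B : FK.RlfAmb), Nonempty (A ≅ FK.rlfModel) → Nonempty (B ≅ FK.rlfModel) →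
        Function.Bijective fun r : A ≅ B => fun v => (FK.rlfFm v).mapIso r :=
  (cor56iKit_iff_rlfDetermined h02 h53ii h53iv).trans (rlfDetermined_iff_component_bijective hfr)

/-- The same with the frames hypothesis discharged by the printed claim of Rmk 5.2.1 (ii) (`RlfOfIsStrip`: "`‡𝔉 ↦ ‡𝔉^⊩`
forms an `ℱ^⊩`-prime-strip"). PROVED. ([IUTchI] Rmk 5.2.1 (ii) p.143) [claim: Mochizuki2012, status: disputed] -/
theorem cor56iKit_iff_component_bijective_of_rlfOfIsStrip (hstrip : FK.RlfOfIsStrip)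
    (h02 : FK.ThToFBijOnGood) (h53ii : FK.IsomFtoDBijective) (h53iv : FK.AutTemperedBijective) :
    FK.Cor56iKit ↔
      ∀ (A B : FK.RlfAmb), Nonempty (A ≅ FK.rlfModel) → Nonempty (B ≅ FK.rlfModel) →
        Function.Bijective fun r : A ≅ B => fun v => (FK.rlfFm v).mapIso r :=
  cor56iKit_iff_component_bijective (nonempty_rlfFm_rlfModel_iso_of_rlfOfIsStrip hstrip) h02 h53ii h53iv

end FKit

end PMBaseKit

/-! ### Re-indexing families along a bijection of index sets (plumbing for `T.e : T.kit.V ≃ V̲`) -/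

section Reindex

variable {ι κ : Type*} {X : Sort*} {Q : κ → Sort*}

/-- Pre-composing a family-valued map with a re-indexing bijection is post-composition with the re-indexing
equivalence of families. [folklore] -/
private theorem reindex_eq_piCongrLeft_symm_comp (e : ι ≃ κ) (f : X → ∀ k, Q k) :
    (fun x i => f x (e i)) = (Equiv.piCongrLeft Q e).symm ∘ f := by
  funext x i
  simp only [Function.comp_apply, Equiv.piCongrLeft_symm_apply]

/-- Bijectivity of a family-valued map is invariant under re-indexing the families along a bijection. [folklore] -/
private theorem bijective_reindex_iff (e : ι ≃ κ) (f : X → ∀ k, Q k) :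
    (Function.Bijective fun x i => f x (e i)) ↔ Function.Bijective f := by
  rw [reindex_eq_piCongrLeft_symm_comp e f]
  exact Equiv.comp_bijective _ _

/-- Injectivity of a family-valued map is invariant under re-indexing the families along a bijection. [folklore] -/
private theorem injective_reindex_iff (e : ι ≃ κ) (f : X → ∀ k, Q k) :
    (Function.Injective fun x i => f x (e i)) ↔ Function.Injective f := by
  rw [reindex_eq_piCongrLeft_symm_comp e f]
  exact Equiv.comp_injective _ _

/-- Surjectivity of a family-valued map is invariant under re-indexing the families along a bijection. [folklore] -/
private theorem surjective_reindex_iff (e : ι ≃ κ) (f : X → ∀ k, Q k) :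
    (Function.Surjective fun x i => f x (e i)) ↔ Function.Surjective f := by
  rw [reindex_eq_piCongrLeft_symm_comp e f]
  exact Equiv.comp_surjective _ _

end Reindex

/-! ### At the §3 ↔ §5 link: the residual law on abc-iut-L5-t2's `HodgeTheaterModel` -/

section Link

variable {F : Type u} {K : Type v} {Fbar : Type w} [Field F] [NumberField F] [Field K]
  [NumberField K] [Algebra F K] [Field Fbar] [Algebra F Fbar] [Algebra K Fbar]
  {E : WeierstrassCurve F} [E.IsElliptic] {l : ℕ} {P : BadPlacePredicates K}
  {D : InitialThetaData F K Fbar E l P}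

namespace HodgeTheaterModel

namespace FKitLink

variable {Mo : HodgeTheaterModel.{u, v, w, uK} D} {T : InitialThetaData.PlaceKit.{uK} D} {M : T.kit.MultKit}

variable (L : Mo.FKitLink T M)

/-- At the link the frames hypothesis holds: the `v̲`-component of `𝔉^⊩_mod` IS `ℱ^⊢_v̲ = dashOf(ℱ̲_v̲)` (abc-iut-L5-t2's
`componentRef`, Ex 3.5 (ii)). PROVED. ([IUTchI] Ex 3.5 p.85) [claim: Mochizuki2012, status: disputed] -/
theorem frames (x : T.kit.V) : Nonempty ((L.toFKit.rlfFm x).obj L.toFKit.rlfModel ≅ L.toFKit.fmModel x) :=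
  ⟨Mo.componentRef (T.e x)⟩

/-- **Row L03 at the link ⟺ the component-bijectivity law on `HodgeTheaterModel`**: for `A, B : Mo.Glob` isomorphic
to `𝔉^⊩_mod`, `Isom(A, B) → ∏_{v̲ ∈ V̲} Isom(component_v̲ A, component_v̲ B)` is bijective.  The right-hand side does not
mention the link `L`, the place kit `T` or the multiplicative kit `M`. PROVED.
([IUTchI] Cor 5.6 (i) p.154) [claim: Mochizuki2012, status: disputed] -/
theorem rlfDetermined_iff_component_bijective :
    L.toFKit.RlfDetermined ↔
      ∀ (A B : Mo.Glob), Nonempty (A ≅ Mo.FmodRef) → Nonempty (B ≅ Mo.FmodRef) →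
        Function.Bijective fun r : A ≅ B => fun v : ↥D.V => (Mo.component v).mapIso r := by
  refine (PMBaseKit.FKit.rlfDetermined_iff_component_bijective L.frames).trans ?_
  refine forall_congr' fun A => forall_congr' fun B => forall_congr' fun _ => forall_congr' fun _ => ?_
  exact bijective_reindex_iff T.e fun (r : A ≅ B) (v : ↥D.V) => (Mo.component v).mapIso r

/-- Likewise for the two halves: L03a at the link ⟺ injectivity on `V̲`-components …
([IUTchI] Rmk 5.2.1 (ii) p.143) [claim: Mochizuki2012, status: disputed] -/
theorem rlfIsoFaithful_iff_component_injective :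
    L.toFKit.RlfIsoFaithful ↔
      ∀ (A B : Mo.Glob), Nonempty (A ≅ Mo.FmodRef) → Nonempty (B ≅ Mo.FmodRef) →
        Function.Injective fun r : A ≅ B => fun v : ↥D.V => (Mo.component v).mapIso r := by
  refine (PMBaseKit.FKit.rlfIsoFaithful_iff_component_injective L.frames).trans ?_
  refine forall_congr' fun A => forall_congr' fun B => forall_congr' fun _ => forall_congr' fun _ => ?_
  exact injective_reindex_iff T.e fun (r : A ≅ B) (v : ↥D.V) => (Mo.component v).mapIso r

/-- … and L03b at the link ⟺ surjectivity on `V̲`-components. ([IUTchI] Cor 5.6 (i) p.154) [claim: Mochizuki2012, status: disputed] -/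
theorem rlfIsoLifts_iff_component_surjective :
    L.toFKit.RlfIsoLifts ↔
      ∀ (A B : Mo.Glob), Nonempty (A ≅ Mo.FmodRef) → Nonempty (B ≅ Mo.FmodRef) →
        Function.Surjective fun r : A ≅ B => fun v : ↥D.V => (Mo.component v).mapIso r := by
  refine (PMBaseKit.FKit.rlfIsoLifts_iff_component_surjective L.frames).trans ?_
  refine forall_congr' fun A => forall_congr' fun B => forall_congr' fun _ => forall_congr' fun _ => ?_
  exact surjective_reindex_iff T.e fun (r : A ≅ B) (v : ↥D.V) => (Mo.component v).mapIso r

/-- **[IUTchI] Cor 5.6 (i) at the link ⟺ the component-bijectivity law on `HodgeTheaterModel`.**  For the kit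
`L.toFKit` read off abc-iut-L5-t2's reference data through ANY link `L`, and given Cor 5.3 (ii) (`IsomFtoDBijective`) and
Cor 5.3 (iv) (`AutTemperedBijective`) BY NAME (nodes IUTchI:Cor5.3(ii)/(iv); L02 holds by `FKitLink.thToFBijOnGood`),
"the natural functorially induced map `Isom(†ℋ𝒯^Θ, ‡ℋ𝒯^Θ) → Isom(†𝔇_>, ‡𝔇_>)` is bijective" (Cor 5.6 (i)) holds IF AND
ONLY IF: for all `A, B : Mo.Glob` isomorphic to `𝔉^⊩_mod`, `r ↦ {(Mo.component v̲).mapIso r}_{v̲ ∈ V̲}` is a bijection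
`Isom(A, B) ⥲ ∏_{v̲} Isom(A_v̲, B_v̲)` — the exact residual of node IUTchI:Cor5.6(i) on the §3 interface
(plan/GAP-LEDGER.md G-w5d217-1).  PROVED; nothing asserted. ([IUTchI] Cor 5.6 (i) p.153) [claim: Mochizuki2012, status: disputed] -/
theorem cor56iKit_iff_component_bijective (h53ii : L.toFKit.IsomFtoDBijective)
    (h53iv : L.toFKit.AutTemperedBijective) :
    L.toFKit.Cor56iKit ↔
      ∀ (A B : Mo.Glob), Nonempty (A ≅ Mo.FmodRef) → Nonempty (B ≅ Mo.FmodRef) →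
        Function.Bijective fun r : A ≅ B => fun v : ↥D.V => (Mo.component v).mapIso r :=
  (PMBaseKit.FKit.cor56iKit_iff_rlfDetermined L.thToFBijOnGood h53ii h53iv).trans
    L.rlfDetermined_iff_component_bijective

end FKitLink

/-! ### Independence at the interface level: the law fails at the KIT-RULE inhabitant `unitsLink D` -/

/-- At abc-iut-L5-t3's inhabitant `unitsModel D` (`Glob = {±1}`, `component v̲ = 𝟭`) the surjectivity half of the
component-bijectivity law FAILS for every initial Θ-datum `D`: `V̲` is infinite (`InitialThetaData.infinite_coe_V`), and
the family of automorphisms that is `−1` at one place `v̲₁` and `+1` elsewhere is not induced by a single sign. PROVED.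
([IUTchI] Ex 3.5 p.85) [claim: Mochizuki2012, status: disputed] -/
theorem not_component_surjective_unitsModel (D : InitialThetaData F K Fbar E l P) :
    ¬ ∀ (A B : (unitsModel D).Glob), Nonempty (A ≅ (unitsModel D).FmodRef) →
        Nonempty (B ≅ (unitsModel D).FmodRef) →
          Function.Surjective fun r : A ≅ B => fun v : ↥D.V => ((unitsModel D).component v).mapIso r := by
  intro h
  letI := Classical.decEq ↥D.V
  haveI : Infinite ↥D.V := D.infinite_coe_V
  obtain ⟨v₁, v₂, hne⟩ := exists_pair_ne ↥D.V
  -- the automorphism `-1` of the unique object of `{±1}`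
  let neg : (SingleObj.star ℤˣ : SingleObj ℤˣ) ≅ SingleObj.star ℤˣ :=
    ⟨(-1 : ℤˣ), (-1 : ℤˣ), by show (-1 : ℤˣ) * (-1) = 1; rw [neg_mul_neg, mul_one],
      by show (-1 : ℤˣ) * (-1) = 1; rw [neg_mul_neg, mul_one]⟩
  obtain ⟨r, hr⟩ := h (SingleObj.star ℤˣ) (SingleObj.star ℤˣ) ⟨Iso.refl _⟩ ⟨Iso.refl _⟩
    (Function.update (fun _ => Iso.refl _) v₁ neg)
  have e₁ : ((unitsModel D).component v₁).mapIso r = neg := by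
    have := congrFun hr v₁
    rwa [Function.update_self] at this
  have e₂ : ((unitsModel D).component v₂).mapIso r = Iso.refl _ := by
    have := congrFun hr v₂
    rwa [Function.update_of_ne hne.symm] at this
  have h12 : neg = Iso.refl _ := e₁.symm.trans e₂
  have hhom := congrArg Iso.hom h12
  change (-1 : ℤˣ) = (1 : ℤˣ) at hhom
  exact absurd hhom (by decide)

/-- Hence the component-bijectivity law fails at `unitsModel D`. ([IUTchI] Ex 3.5 p.85) [claim: Mochizuki2012, status: disputed] -/
theorem not_component_bijective_unitsModel (D : InitialThetaData F K Fbar E l P) :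
    ¬ ∀ (A B : (unitsModel D).Glob), Nonempty (A ≅ (unitsModel D).FmodRef) →
        Nonempty (B ≅ (unitsModel D).FmodRef) →
          Function.Bijective fun r : A ≅ B => fun v : ↥D.V => ((unitsModel D).component v).mapIso r :=
  fun h => not_component_surjective_unitsModel D fun A B hA hB => (h A B hA hB).2

/-- Hence row L03b FAILS for the kit of the witness link … ([IUTchI] Cor 5.6 (i) p.154) [claim: Mochizuki2012, status: disputed] -/
theorem not_rlfIsoLifts_unitsLink (D : InitialThetaData F K Fbar E l P) : ¬ (unitsLink D).toFKit.RlfIsoLifts :=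
  fun h => not_component_surjective_unitsModel D ((unitsLink D).rlfIsoLifts_iff_component_surjective.mp h)

/-- … row L03 FAILS there … ([IUTchI] Cor 5.6 (i) p.154) [claim: Mochizuki2012, status: disputed] -/
theorem not_rlfDetermined_unitsLink (D : InitialThetaData F K Fbar E l P) :
    ¬ (unitsLink D).toFKit.RlfDetermined := fun h =>
  not_rlfIsoLifts_unitsLink D (PMBaseKit.FKit.rlfIsoLifts_of_rlfDetermined h)

/-- … while Cor 5.3 (ii) HOLDS there (`ℱ_v ↦ 𝒟_v` is `𝟭 ⋙ unitsFunctor`, fully faithful) … ([IUTchI] Cor 5.3 (ii) p.144) [claim: Mochizuki2012, status: disputed] -/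
theorem isomFtoDBijective_unitsLink (D : InitialThetaData F K Fbar E l P) :
    (unitsLink D).toFKit.IsomFtoDBijective :=
  haveI : Fact l.Prime := ⟨D.l_prime⟩
  PMBaseKit.FKit.isomFtoDBijective_of_fullyFaithful fun _ =>
    (Functor.FullyFaithful.id _).comp (PMBaseKit.Model.unitsFunctorFullyFaithful l)

/-- … and Cor 5.3 (iv) HOLDS there (`ℱ̲_v ↦ ℱ_v ↦ 𝒟_v` is `𝟭 ⋙ 𝟭 ⋙ unitsFunctor`) … ([IUTchI] Cor 5.3 (iv) p.144) [claim: Mochizuki2012, status: disputed] -/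
theorem autTemperedBijective_unitsLink (D : InitialThetaData F K Fbar E l P) :
    (unitsLink D).toFKit.AutTemperedBijective :=
  haveI : Fact l.Prime := ⟨D.l_prime⟩
  fun _ _ => ((Functor.FullyFaithful.id _).comp
    ((Functor.FullyFaithful.id _).comp (PMBaseKit.Model.unitsFunctorFullyFaithful l))).isoEquiv.bijective

/-- **Independence of [IUTchI] Cor 5.6 (i) at the interface level**: for EVERY initial Θ-datum `D`, the kit of
abc-iut-L5-t3's KIT-RULE inhabitant `unitsLink D` of the §3 ↔ §5 dictionary satisfies L02 and Cor 5.3 (ii), (iv), yet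
`Cor56iKit` FAILS — so Cor 5.6 (i) is not a consequence of abc-iut-L5-t2's `HodgeTheaterModel` axioms, the dictionary and
Cor 5.3 (ii), (iv); the component-bijectivity law (G-w5d217-1) is genuinely additional.  PROVED (a statement about the
typed interfaces, not about the series). ([IUTchI] Cor 5.6 (i) p.153) [claim: Mochizuki2012, status: disputed] -/
theorem not_cor56iKit_unitsLink (D : InitialThetaData F K Fbar E l P) : ¬ (unitsLink D).toFKit.Cor56iKit := fun h =>
  not_rlfDetermined_unitsLink D
    (PMBaseKit.FKit.rlfDetermined_of_cor56iKit h (unitsLink D).thToFBijOnGood (isomFtoDBijective_unitsLink D)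
      (autTemperedBijective_unitsLink D))

end HodgeTheaterModel

end Link

end Literature.IUT.HodgeTheaters
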